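import Summits.HubbardSuperconductivity.HubbardSuperconductivity.Theorems.AnisotropyChordTransferTwoMagnonScreeningLemmas

/-!
# Route `AnisotropyChord` / H0 rotor rung: PORT SPEC N29 — the FREE GAP in the `K₁` three-magnon fibre (`freeGap_K1`)

Theory seat `hubbard-h0-rotor-theory-1`, cycle 20, memo ROTOR-THEORY-20 §267 (LEMMA SHELL-LOG, step (1)) and §268 (PORT SPEC N29,
«optional, elementary, for the prover seat; statement over `Real.cos`, no matrices»):

  for `L ≥ 4` and lattice momenta `k₁ + k₂ + k₃ ≡ K₁ = (2π/L, 0)` that are NOT a permutation of `(K₁, 0, 0)` (the three pole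
  states), `ε(k₁) + ε(k₂) + ε(k₃) ≥ 3ε₁`, where `ε(k) = 2 − cos kₓ − cos k_y`, `ε₁ = 1 − cos(2π/L)`.

Momenta are written by their residues `(m, n) ∈ [0, L)²` (`k = (2πm/L, 2πn/L)`); the constraint `k₁ + k₂ + k₃ ≡ K₁ (mod 2π)` reads
`m₁ + m₂ + m₃ ∈ {1, L+1, 2L+1}`, `n₁ + n₂ + n₃ ∈ {0, L, 2L}`; «permutation of the pole» ⟺ «two of the three momenta vanish»
(the third is then forced to be `K₁`).  Proof (memo §267 (1)): with `e(j) = 1 − cos(2πj/L)` (`= screenS L j / 2` of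
`…TransferTwoMagnonScreeningLemmas`): `e(j) ≥ e(1)` for `j ≠ 0`, `e(j) ≥ e(2)` for `2 ≤ j ≤ L − 2`, and `e(2) ≥ 2e(1)` for `L ≥ 4`
(`⟺ cos(2π/L) ≥ 0`); no zero momentum ⇒ each `ε ≥ e(1)`; one zero momentum ⇒ `ε(k) + ε(K₁ − k) ≥ 3e(1)` by the two facts.
Also `freeGap_K1_sub`: the form `e_tot − ε₁ − T ≥ e_tot/3` for `T ≤ ε₁` used as the denominator bound in LEMMA SHELL-LOG.

Prover seat `hubbard-h0-rotor-p1` g21; helper for stmt-HubbardSuperconductivity-19089 (`--supports`).  Nothing here is a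
statement about the Hubbard model.
-/

set_option linter.dupNamespace false
set_option autoImplicit false

noncomputable section

open Finset Real

namespace Summit.HubbardSuperconductivity.HubbardSuperconductivity.Theorems.AnisotropyChord.Transfer

/-! ## One-dimensional kinetic energies `e(j) = 1 − cos(2πj/L) = S_j/2` -/

/-- `S_2 ≤ S_k` for `2 ≤ k ≤ L − 2` (`cos(2πk/L) ≤ cos(4π/L)`), `L ≥ 4`. [folklore] -/
theorem screenS_two_le {L k : ℕ} (hk : 2 ≤ k) (hkL : k + 2 ≤ L) : screenS L 2 ≤ screenS L k := by
  unfold screenS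
  have hL : (0 : ℝ) < L := by exact_mod_cast (show 0 < L by omega)
  have hk' : (2 : ℝ) ≤ k := by exact_mod_cast hk
  have hkL' : (k : ℝ) + 2 ≤ L := by exact_mod_cast hkL
  have hpi := Real.pi_pos
  have h2 : (0 : ℝ) ≤ 2 * Real.pi * ((2 : ℕ) : ℝ) / L := by positivity
  suffices h : Real.cos (2 * Real.pi * k / L) ≤ Real.cos (2 * Real.pi * ((2 : ℕ) : ℝ) / L) by linarith
  by_cases hcase : 2 * k ≤ L
  · have hcase' : 2 * (k : ℝ) ≤ L := by exact_mod_cast hcase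
    apply Real.cos_le_cos_of_nonneg_of_le_pi h2
    · rw [div_le_iff₀ hL]; nlinarith
    · push_cast; gcongr
  · rw [not_le] at hcase
    have hcase' : (L : ℝ) < 2 * k := by exact_mod_cast hcase
    rw [← Real.cos_two_pi_sub]
    apply Real.cos_le_cos_of_nonneg_of_le_pi h2
    · rw [sub_le_iff_le_add]
      have : Real.pi ≤ 2 * Real.pi * k / L := by
        rw [le_div_iff₀ hL]; nlinarith
      linarith
    · push_cast
      rw [le_sub_iff_add_le, ← add_div, div_le_iff₀ hL]
      nlinarith

/-- `2·S_1 ≤ S_2` for `L ≥ 4` (`S_2 = 4cos²(π/L)·S_1` and `cos(π/L) ≥ cos(π/4) = √2/2`). [folklore] -/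
theorem two_screenS_one_le {L : ℕ} (hL : 4 ≤ L) : 2 * screenS L 1 ≤ screenS L 2 := by
  rw [screenS_two]
  have hL' : (4 : ℝ) ≤ L := by exact_mod_cast hL
  have hpi := Real.pi_pos
  have hc : Real.sqrt 2 / 2 ≤ Real.cos (Real.pi / L) := by
    rw [← Real.cos_pi_div_four]
    apply Real.cos_le_cos_of_nonneg_of_le_pi
    · positivity
    · have : Real.pi / 4 ≤ Real.pi := by linarith
      exact this
    · exact div_le_div_of_nonneg_left hpi.le (by norm_num) hL'
  have hs : (Real.sqrt 2 / 2) ^ 2 = 1 / 2 := by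
    rw [div_pow, Real.sq_sqrt (by norm_num)]; norm_num
  have hc2 : 1 / 2 ≤ Real.cos (Real.pi / L) ^ 2 := by
    rw [← hs]
    exact pow_le_pow_left₀ (by positivity) hc 2
  have hS := screenS_nonneg L 1
  nlinarith

/-- `e(j) := 1 − cos(2πj/L) = S_j / 2`, the one-dimensional kinetic energy. [folklore] -/
theorem one_sub_cos_eq_half_screenS (L j : ℕ) : 1 - Real.cos (2 * Real.pi * j / L) = screenS L j / 2 := by
  unfold screenS; ring

/-! ## The free gap -/

/-- the two-momentum step: if `k = (m, n) ≠ 0`, `k' = (m', n') ≠ 0` and `k + k' ≡ K₁` (residues: `m + m' ∈ {1, L+1}`,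
`n + n' ∈ {0, L}`), then `ε(k) + ε(k') ≥ 3ε₁` (`L ≥ 4`). [folklore] -/
theorem freeGap_pair {L : ℕ} (hL : 4 ≤ L) (m n m' n' : ℕ) (hm : m < L) (hn : n < L) (hm' : m' < L) (hn' : n' < L)
    (hsm : m + m' = 1 ∨ m + m' = L + 1) (hsn : n + n' = 0 ∨ n + n' = L)
    (hk : ¬ (m = 0 ∧ n = 0)) (hk' : ¬ (m' = 0 ∧ n' = 0)) :
    3 * screenS L 1 ≤ screenS L m + screenS L n + (screenS L m' + screenS L n') := by
  have e0 : screenS L 0 = 0 := screenS_zero L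
  have hge1 : ∀ j : ℕ, j ≠ 0 → j < L → screenS L 1 ≤ screenS L j :=
    fun j hj hjL => screenS_one_le (by omega) (by omega)
  have hge2 : ∀ j : ℕ, 2 ≤ j → j + 2 ≤ L → screenS L 2 ≤ screenS L j :=
    fun j hj hjL => screenS_two_le hj hjL
  have h21 := two_screenS_one_le hL
  have hnn := fun j => screenS_nonneg L j
  by_cases hn0 : n = 0
  · -- then `n' = 0`, `m, m' ≠ 0`, `m + m' = L + 1`
    have hn'0 : n' = 0 := by omega
    subst hn0; subst hn'0
    have hm0 : m ≠ 0 := fun h => hk ⟨h, rfl⟩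
    have hm'0 : m' ≠ 0 := fun h => hk' ⟨h, rfl⟩
    rw [e0]
    by_cases hmid : m + 2 ≤ L
    · -- `2 ≤ m ≤ L − 2`: `e(m) ≥ e(2) ≥ 2e(1)`, `e(m') ≥ e(1)`
      have h1 := hge2 m (by omega) hmid
      have h2 := hge1 m' hm'0 hm'
      linarith
    · -- `m = L − 1`, `m' = 2`
      have hm'2 : m' = 2 := by omega
      subst hm'2
      have h1 := hge1 m hm0 hm
      linarith
  · -- `n ≠ 0`, hence `n' = L − n ≠ 0`; and `m, m'` are not both zero
    have hn'0 : n' ≠ 0 := by omega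
    have h1 := hge1 n hn0 hn
    have h2 := hge1 n' hn'0 hn'
    have h3 : screenS L 1 ≤ screenS L m + screenS L m' := by
      by_cases hm0 : m = 0
      · subst hm0
        have hm'0 : m' ≠ 0 := by omega
        have := hge1 m' hm'0 hm'
        rw [e0]; linarith
      · have := hge1 m hm0 hm
        linarith [hnn m']
    linarith

/-- **PORT SPEC N29 — `freeGap_K1` (memo ROTOR-THEORY-20 §267 (1), §268).**  For `L ≥ 4` and three lattice momenta
`kᵢ = (2πmᵢ/L, 2πnᵢ/L)`, `0 ≤ mᵢ, nᵢ < L`, with `k₁ + k₂ + k₃ ≡ K₁ = (2π/L, 0)` (i.e. `m₁+m₂+m₃ ∈ {1, L+1, 2L+1}`,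
`n₁+n₂+n₃ ∈ {0, L, 2L}`) which are not a permutation of the pole `(K₁, 0, 0)` (i.e. no two of them vanish):
`ε(k₁) + ε(k₂) + ε(k₃) ≥ 3·(1 − cos(2π/L))`, `ε(k) = 2 − cos kₓ − cos k_y`.
[conjecture: theory seat hubbard-h0-rotor-theory-1, cycle 20, memo ROTOR-THEORY-20 §267 — elementary; proved here] -/
theorem freeGap_K1 {L : ℕ} (hL : 4 ≤ L) (m₁ n₁ m₂ n₂ m₃ n₃ : ℕ)
    (hm₁ : m₁ < L) (hn₁ : n₁ < L) (hm₂ : m₂ < L) (hn₂ : n₂ < L) (hm₃ : m₃ < L) (hn₃ : n₃ < L)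
    (hm : m₁ + m₂ + m₃ = 1 ∨ m₁ + m₂ + m₃ = L + 1 ∨ m₁ + m₂ + m₃ = 2 * L + 1)
    (hn : n₁ + n₂ + n₃ = 0 ∨ n₁ + n₂ + n₃ = L ∨ n₁ + n₂ + n₃ = 2 * L)
    (hpole : ¬ ((m₁ = 0 ∧ n₁ = 0 ∧ m₂ = 0 ∧ n₂ = 0) ∨ (m₁ = 0 ∧ n₁ = 0 ∧ m₃ = 0 ∧ n₃ = 0)
      ∨ (m₂ = 0 ∧ n₂ = 0 ∧ m₃ = 0 ∧ n₃ = 0))) :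
    3 * (1 - Real.cos (2 * Real.pi / L))
      ≤ (2 - Real.cos (2 * Real.pi * m₁ / L) - Real.cos (2 * Real.pi * n₁ / L))
        + (2 - Real.cos (2 * Real.pi * m₂ / L) - Real.cos (2 * Real.pi * n₂ / L))
        + (2 - Real.cos (2 * Real.pi * m₃ / L) - Real.cos (2 * Real.pi * n₃ / L)) := by
  -- translate to `S_j = 2 e(j)`
  have hε : ∀ a b : ℕ, 2 - Real.cos (2 * Real.pi * a / L) - Real.cos (2 * Real.pi * b / L)
      = (screenS L a + screenS L b) / 2 := by
    intro a b; unfold screenS; ring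
  have hε₁ : 1 - Real.cos (2 * Real.pi / L) = screenS L 1 / 2 := by
    unfold screenS; push_cast; ring_nf
  rw [hε, hε, hε, hε₁]
  have e0 : screenS L 0 = 0 := screenS_zero L
  have hge1 : ∀ j : ℕ, j ≠ 0 → j < L → screenS L 1 ≤ screenS L j :=
    fun j hj hjL => screenS_one_le (by omega) (by omega)
  have hnn := fun j => screenS_nonneg L j
  -- one momentum nonzero ⇒ its energy is ≥ e(1)
  have hone : ∀ a b : ℕ, a < L → b < L → ¬ (a = 0 ∧ b = 0) → screenS L 1 ≤ screenS L a + screenS L b := by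
    intro a b ha hb hab
    by_cases ha0 : a = 0
    · have hb0 : b ≠ 0 := fun h => hab ⟨ha0, h⟩
      have := hge1 b hb0 hb
      linarith [hnn a]
    · have := hge1 a ha0 ha
      linarith [hnn b]
  by_cases hz3 : m₃ = 0 ∧ n₃ = 0
  · obtain ⟨rfl, rfl⟩ := hz3
    have hk1 : ¬ (m₁ = 0 ∧ n₁ = 0) := fun h => hpole (Or.inr (Or.inl ⟨h.1, h.2, rfl, rfl⟩))
    have hk2 : ¬ (m₂ = 0 ∧ n₂ = 0) := fun h => hpole (Or.inr (Or.inr ⟨h.1, h.2, rfl, rfl⟩))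
    have h := freeGap_pair hL m₁ n₁ m₂ n₂ hm₁ hn₁ hm₂ hn₂ (by omega) (by omega) hk1 hk2
    rw [e0]; linarith
  by_cases hz2 : m₂ = 0 ∧ n₂ = 0
  · obtain ⟨rfl, rfl⟩ := hz2
    have hk1 : ¬ (m₁ = 0 ∧ n₁ = 0) := fun h => hpole (Or.inl ⟨h.1, h.2, rfl, rfl⟩)
    have h := freeGap_pair hL m₁ n₁ m₃ n₃ hm₁ hn₁ hm₃ hn₃ (by omega) (by omega) hk1 hz3
    rw [e0]; linarith
  by_cases hz1 : m₁ = 0 ∧ n₁ = 0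
  · obtain ⟨rfl, rfl⟩ := hz1
    have h := freeGap_pair hL m₂ n₂ m₃ n₃ hm₂ hn₂ hm₃ hn₃ (by omega) (by omega) hz2 hz3
    rw [e0]; linarith
  -- no zero momentum
  have h1 := hone m₁ n₁ hm₁ hn₁ hz1
  have h2 := hone m₂ n₂ hm₂ hn₂ hz2
  have h3 := hone m₃ n₃ hm₃ hn₃ hz3
  linarith

/-- the denominator form used in LEMMA SHELL-LOG: off the pole states and for `T ≤ ε₁`,
`e_tot − ε₁ − T ≥ e_tot / 3 > 0`-type bound, here as `e_tot − ε₁ − T ≥ e_tot/3` given `e_tot ≥ 3ε₁`. [folklore] -/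
theorem freeGap_K1_den {etot eps1 T : ℝ} (h : 3 * eps1 ≤ etot) (hT : T ≤ eps1) : etot / 3 ≤ etot - eps1 - T := by
  linarith

end Summit.HubbardSuperconductivity.HubbardSuperconductivity.Theorems.AnisotropyChord.Transfer

end
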